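import Mathlib
import HarnessLib
import Summits.Ventures.LatticeQCDFlow.Scaling.AcceptanceGiniFloor

/-!
# LatticeQCDFlow / Scoring — the bias of an UNCORRECTED flow sampler (planted control X-1,
# "Metropolis step disabled"): `|E_q f − E_p f| ≤ σ_q(f)·√(1/ESS − 1)`, sharp, and what the
# plaquette prong of INVALID-1 can and cannot see

HONEST FRAMING: exact (Metropolis-corrected) sampling algorithms for lattice gauge theory;
figures of merit are autocorrelation/cost numbers at stated couplings and volumes; no
continuum-physics claim.

Venture `LatticeQCDFlow` (cell pub-lqcd), sub-topic `Scoring`; FANOUT row 3 (`s0-u1-a`, S0-B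
implementation A, GEN-7).  NEW WORK of the cell (one covariance identity and one Cauchy–Schwarz
step over finite sums), not a published result; NO definition is introduced.  Companion of row 3's
`Scaling/AcceptanceGiniFloor` (`E_q w² = 1/ESS`) and of `Exactness/ComputedDensity` (the OTHER
planted control, X-2 "log-det dropped": an independence sampler run with a mis-computed model density
is exact for the TILTED law — that file, not this one).

## Why

The frozen fitness text defines the planted-invalid control **INVALID-1 / X-1** of every 2-d flow
row as "Metropolis step disabled → flagged INVALID (plaquette ≠ exact at > 3σ with 10⁶ samples AND
the `accepted` field constant)" (HOME/FITNESS.md §2), and arm A wrote an X-1 twin of every cell from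
the SAME proposals (HOME/s0-u1-a/CARD-S0B-A.md, P3).  With the accept/reject step removed the
"chain" is an i.i.d. sample of the MODEL `q` (the flow's push-forward), so every estimator converges
to `E_q f` instead of the target value `E_p f`.  This file types how large that bias can be in the
units the plaquette test measures it in, and why the test needs its second prong.

## Content (finite configuration space `X`; target `p` normalised; model `q > 0` normalised;
## `w = p/q` the importance weight, `E_q w = 1`, `Var_q w = E_q w² − 1 = 1/ESS − 1 = χ²(p‖q)`)

* `uncorrected_bias_eq_weightCov` — for every observable `f` and every centring constant `c`:
  `E_p f − E_q f = Σ_x q_x (w_x − 1)(f_x − c)` (`= Cov_q(w, f)`): the bias of the uncorrected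
  sampler on `f` is exactly the model covariance of `f` with the importance weight;
* `model_variance_weight_eq` — `Σ_x q_x (w_x − 1)² = 1/ESS − 1`;
* `sq_uncorrected_bias_le` / `abs_uncorrected_bias_le` — Cauchy–Schwarz:
  `(E_p f − E_q f)² ≤ Var_q^{(c)}(f) · (1/ESS − 1)` for every centre `c` (smallest at `c = E_q f`),
  i.e. `|bias| ≤ σ_q(f)·√(1/ESS − 1)`; [folklore: the `χ²`-bound on a change of measure]
* `uncorrected_bias_affine` / `sq_uncorrected_bias_affine_eq` — EQUALITY for observables affine in
  the weight, `f = a + b·w`: bias `= b·(1/ESS − 1)`, variance `= b²·(1/ESS − 1)`; in particular the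
  weight itself is biased by exactly `χ²(p‖q)`; the constant is best possible;
* `zsq_le_of_uncorrected_flag` — THE READING FOR THE PLAQUETTE PRONG: if a `z₀`-σ flag is raised by
  the population `z`-value of an `n`-sample i.i.d. test with the model's own spread,
  `z₀·σ_q(f) ≤ √n·|E_p f − E_q f|`, then `z₀² ≤ n·(1/ESS − 1)`.  So the plaquette prong ALONE can
  separate X-1 from VALID at `3σ` only when `n·(1/ESS − 1) ≥ 9`; its population `z` is
  `√n·|corr_q(f, w)|·√(1/ESS − 1)` — large for a poorly trained flow, but ZERO for any observable
  uncorrelated with the weight under the model, however small the ESS: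
* `exists_uncorrected_blind_observable` — an explicit fully supported normalised pair on `Fin 3`
  with `ESS = 8/9 < 1` and a non-constant observable whose uncorrected bias is exactly `0`.  Hence
  the second prong of INVALID-1 (the `accepted` field is constant) is not redundant: it is the
  prong that does not depend on the observable.

NOT CLAIMED: any value of an ESS, bias, `z` or correlation of ours; anything about the SAMPLE
`z` (the statements are about its population value `√n·|bias|/σ_q(f)`; the scorers' V1 uses the
run's own error estimate); anything about X-2 (see `Exactness/ComputedDensity`); nothing re-scored.
-/

namespace Summit.Ventures.LatticeQCDFlow.Scoring

open Finset
open Summit.Ventures.LatticeQCDFlow.Theory2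

variable {X : Type*} [Fintype X]

/-! ### The bias is a covariance with the weight -/

/-- **Bias identity.**  For a normalised target `p`, a positive normalised model `q`, `w = p/q`,
every observable `f` and every centring constant `c`:
`E_p f − E_q f = Σ_x q_x (w_x − 1)(f_x − c)` — the bias of the uncorrected (accept-all) flow sampler
is the model covariance of the observable with the importance weight (`E_q w = 1`, so the centre
`c` is free). [folklore] -/
theorem uncorrected_bias_eq_weightCov {p q : X → ℝ} (hq : ∀ x, 0 < q x) (hp1 : ∑ x, p x = 1)
    (hq1 : ∑ x, q x = 1) (f : X → ℝ) (c : ℝ) :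
    ∑ x, p x * f x - ∑ x, q x * f x = ∑ x, q x * (weight p q x - 1) * (f x - c) := by
  have h : ∀ x, q x * (weight p q x - 1) * (f x - c)
      = p x * f x - q x * f x - c * p x + c * q x := by
    intro x
    have hw : q x * weight p q x = p x := mul_weight (hq x).ne'
    calc q x * (weight p q x - 1) * (f x - c)
        = (q x * weight p q x) * f x - q x * f x - c * (q x * weight p q x) + c * q x := by ring
      _ = p x * f x - q x * f x - c * p x + c * q x := by rw [hw]
  simp_rw [h]
  rw [sum_add_distrib, sum_sub_distrib, sum_sub_distrib, ← mul_sum, ← mul_sum, hp1, hq1]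
  ring

/-- **`Var_q w = χ²(p‖q) = 1/ESS − 1`**: `Σ_x q_x (w_x − 1)² = 1/ESS − 1`. [folklore] -/
theorem model_variance_weight_eq {p q : X → ℝ} (hq : ∀ x, 0 < q x) (hp1 : ∑ x, p x = 1)
    (hq1 : ∑ x, q x = 1) :
    ∑ x, q x * (weight p q x - 1) ^ 2 = (essFrac p q)⁻¹ - 1 := by
  have hS1 : ∑ x, q x * weight p q x = 1 := sum_mul_weight hq hp1
  have hS2 : ∑ x, q x * weight p q x ^ 2 = (essFrac p q)⁻¹ :=
    sum_mul_weight_sq_eq_inv_essFrac hq hp1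
  have h : ∀ x, q x * (weight p q x - 1) ^ 2
      = q x * weight p q x ^ 2 - 2 * (q x * weight p q x) + q x := fun x => by ring
  simp_rw [h]
  rw [sum_add_distrib, sum_sub_distrib, ← mul_sum, hS1, hS2, hq1]
  ring

/-- `0 ≤ 1/ESS − 1` (it is a variance). [folklore] -/
theorem inv_essFrac_sub_one_nonneg {p q : X → ℝ} (hq : ∀ x, 0 < q x) (hp1 : ∑ x, p x = 1)
    (hq1 : ∑ x, q x = 1) : 0 ≤ (essFrac p q)⁻¹ - 1 := by
  rw [← model_variance_weight_eq hq hp1 hq1]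
  exact sum_nonneg fun x _ => mul_nonneg (hq x).le (sq_nonneg _)

/-! ### Cauchy–Schwarz: `|bias| ≤ σ_q(f)·√(1/ESS − 1)` -/

/-- **The `χ²` bound on the bias of the uncorrected sampler.**  For every observable `f` and every
centre `c`: `(E_p f − E_q f)² ≤ (Σ_x q_x (f_x − c)²)·(1/ESS − 1)`; with `c = E_q f` the first factor
is the model variance of `f`.  Cauchy–Schwarz in the `q`-weighted inner product applied to
`uncorrected_bias_eq_weightCov`. [folklore] -/
theorem sq_uncorrected_bias_le {p q : X → ℝ} (hq : ∀ x, 0 < q x) (hp1 : ∑ x, p x = 1)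
    (hq1 : ∑ x, q x = 1) (f : X → ℝ) (c : ℝ) :
    (∑ x, p x * f x - ∑ x, q x * f x) ^ 2
      ≤ (∑ x, q x * (f x - c) ^ 2) * ((essFrac p q)⁻¹ - 1) := by
  rw [uncorrected_bias_eq_weightCov hq hp1 hq1 f c, ← model_variance_weight_eq hq hp1 hq1]
  have hsq : ∀ x, Real.sqrt (q x) * Real.sqrt (q x) = q x :=
    fun x => Real.mul_self_sqrt (hq x).le
  have hcs := Finset.sum_mul_sq_le_sq_mul_sq (Finset.univ : Finset X)
    (fun x => Real.sqrt (q x) * (f x - c)) (fun x => Real.sqrt (q x) * (weight p q x - 1))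
  have h1 : ∀ x, Real.sqrt (q x) * (f x - c) * (Real.sqrt (q x) * (weight p q x - 1))
      = q x * (weight p q x - 1) * (f x - c) := by
    intro x
    have e : Real.sqrt (q x) * (f x - c) * (Real.sqrt (q x) * (weight p q x - 1))
        = (Real.sqrt (q x) * Real.sqrt (q x)) * ((weight p q x - 1) * (f x - c)) := by ring
    rw [e, hsq x]; ring
  have h2 : ∀ x, (Real.sqrt (q x) * (f x - c)) ^ 2 = q x * (f x - c) ^ 2 := by
    intro x; rw [mul_pow, sq, hsq x]
  have h3 : ∀ x, (Real.sqrt (q x) * (weight p q x - 1)) ^ 2 = q x * (weight p q x - 1) ^ 2 := by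
    intro x; rw [mul_pow, sq, hsq x]
  simp_rw [h1, h2, h3] at hcs
  exact hcs

/-- **`|E_p f − E_q f| ≤ √(Var_q^{(c)} f) · √(1/ESS − 1)`** — the square-root form of
`sq_uncorrected_bias_le`. [folklore] -/
theorem abs_uncorrected_bias_le {p q : X → ℝ} (hq : ∀ x, 0 < q x) (hp1 : ∑ x, p x = 1)
    (hq1 : ∑ x, q x = 1) (f : X → ℝ) (c : ℝ) :
    |∑ x, p x * f x - ∑ x, q x * f x|
      ≤ Real.sqrt (∑ x, q x * (f x - c) ^ 2) * Real.sqrt ((essFrac p q)⁻¹ - 1) := by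
  rw [← Real.sqrt_sq_eq_abs, ← Real.sqrt_mul (sum_nonneg fun x _ => mul_nonneg (hq x).le
    (sq_nonneg _))]
  exact Real.sqrt_le_sqrt (sq_uncorrected_bias_le hq hp1 hq1 f c)

/-! ### Sharpness: observables affine in the weight -/

/-- **Equality case, bias.**  For an observable affine in the weight, `f = a + b·w`, the bias of
the uncorrected sampler is exactly `b·(1/ESS − 1)`; in particular (`a = 0`, `b = 1`) the weight
itself is over-estimated by the target relative to the model by exactly `χ²(p‖q)`. [folklore] -/
theorem uncorrected_bias_affine {p q : X → ℝ} (hq : ∀ x, 0 < q x) (hp1 : ∑ x, p x = 1)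
    (hq1 : ∑ x, q x = 1) (a b : ℝ) :
    ∑ x, p x * (a + b * weight p q x) - ∑ x, q x * (a + b * weight p q x)
      = b * ((essFrac p q)⁻¹ - 1) := by
  rw [uncorrected_bias_eq_weightCov hq hp1 hq1 _ (a + b), ← model_variance_weight_eq hq hp1 hq1,
    mul_sum]
  exact sum_congr rfl fun x _ => by ring

/-- The model variance of `f = a + b·w` about its model mean `a + b` is `b²·(1/ESS − 1)`.
[folklore] -/
theorem model_variance_affine {p q : X → ℝ} (hq : ∀ x, 0 < q x) (hp1 : ∑ x, p x = 1)
    (hq1 : ∑ x, q x = 1) (a b : ℝ) :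
    ∑ x, q x * (a + b * weight p q x - (a + b)) ^ 2 = b ^ 2 * ((essFrac p q)⁻¹ - 1) := by
  rw [← model_variance_weight_eq hq hp1 hq1, mul_sum]
  exact sum_congr rfl fun x _ => by ring

/-- **Equality case of the `χ²` bound.**  For `f = a + b·w` (centred at its model mean `a + b`)
`sq_uncorrected_bias_le` is an identity: `bias² = Var_q f · (1/ESS − 1)`.  The constant in the
bound cannot be improved for any `(p, q)`. [folklore] -/
theorem sq_uncorrected_bias_affine_eq {p q : X → ℝ} (hq : ∀ x, 0 < q x) (hp1 : ∑ x, p x = 1)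
    (hq1 : ∑ x, q x = 1) (a b : ℝ) :
    (∑ x, p x * (a + b * weight p q x) - ∑ x, q x * (a + b * weight p q x)) ^ 2
      = (∑ x, q x * (a + b * weight p q x - (a + b)) ^ 2) * ((essFrac p q)⁻¹ - 1) := by
  rw [uncorrected_bias_affine hq hp1 hq1, model_variance_affine hq hp1 hq1]
  ring

/-! ### The reading for the plaquette prong of INVALID-1 -/

/-- **What a `z₀`-σ plaquette flag on X-1 requires of the flow.**  If the population `z`-value of
an `n`-sample i.i.d. test of `E f = E_p f` run on the uncorrected sampler, with the model's own
spread `σ_q(f) = √(Σ q (f − c)²)` (`c` any centre with positive spread), reaches `z₀ ≥ 0` —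
`z₀·σ_q(f) ≤ √n·|E_p f − E_q f|` — then `z₀² ≤ n·(1/ESS − 1)`.  Contrapositive: a flow with
`ESS > n/(n + z₀²)` cannot be separated from an exact sampler by this prong at level `z₀`, whatever
the observable. [folklore] -/
theorem zsq_le_of_uncorrected_flag {p q : X → ℝ} (hq : ∀ x, 0 < q x) (hp1 : ∑ x, p x = 1)
    (hq1 : ∑ x, q x = 1) (f : X → ℝ) (c : ℝ) {n z₀ : ℝ} (hn : 0 ≤ n) (hz : 0 ≤ z₀)
    (hV : 0 < ∑ x, q x * (f x - c) ^ 2)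
    (hflag : z₀ * Real.sqrt (∑ x, q x * (f x - c) ^ 2)
      ≤ Real.sqrt n * |∑ x, p x * f x - ∑ x, q x * f x|) :
    z₀ ^ 2 ≤ n * ((essFrac p q)⁻¹ - 1) := by
  set V := ∑ x, q x * (f x - c) ^ 2 with hVdef
  set B := ∑ x, p x * f x - ∑ x, q x * f x with hBdef
  have hl : 0 ≤ z₀ * Real.sqrt V := mul_nonneg hz (Real.sqrt_nonneg _)
  have hsq := mul_self_le_mul_self hl hflag
  have hsq' : z₀ ^ 2 * V ≤ n * B ^ 2 := by
    have e1 : z₀ * Real.sqrt V * (z₀ * Real.sqrt V) = z₀ ^ 2 * V := by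
      rw [show z₀ * Real.sqrt V * (z₀ * Real.sqrt V)
          = z₀ ^ 2 * (Real.sqrt V * Real.sqrt V) by ring, Real.mul_self_sqrt hV.le]
    have e2 : Real.sqrt n * |B| * (Real.sqrt n * |B|) = n * B ^ 2 := by
      rw [show Real.sqrt n * |B| * (Real.sqrt n * |B|)
          = (Real.sqrt n * Real.sqrt n) * (|B| * |B|) by ring, Real.mul_self_sqrt hn,
        abs_mul_abs_self, sq]
    rw [← e1, ← e2]; exact hsq
  have hB : B ^ 2 ≤ V * ((essFrac p q)⁻¹ - 1) := sq_uncorrected_bias_le hq hp1 hq1 f c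
  have hchain : z₀ ^ 2 * V ≤ n * ((essFrac p q)⁻¹ - 1) * V := by
    calc z₀ ^ 2 * V ≤ n * B ^ 2 := hsq'
      _ ≤ n * (V * ((essFrac p q)⁻¹ - 1)) := mul_le_mul_of_nonneg_left hB hn
      _ = n * ((essFrac p q)⁻¹ - 1) * V := by ring
  exact le_of_mul_le_mul_right hchain hV

/-- The same reading at the fitness text's level `z₀ = 3`: a `3σ` plaquette flag on X-1 needs
`9 ≤ n·(1/ESS − 1)`. [folklore] -/
theorem nine_le_of_uncorrected_flag_three {p q : X → ℝ} (hq : ∀ x, 0 < q x) (hp1 : ∑ x, p x = 1)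
    (hq1 : ∑ x, q x = 1) (f : X → ℝ) (c : ℝ) {n : ℝ} (hn : 0 ≤ n)
    (hV : 0 < ∑ x, q x * (f x - c) ^ 2)
    (hflag : 3 * Real.sqrt (∑ x, q x * (f x - c) ^ 2)
      ≤ Real.sqrt n * |∑ x, p x * f x - ∑ x, q x * f x|) :
    9 ≤ n * ((essFrac p q)⁻¹ - 1) := by
  have h := zsq_le_of_uncorrected_flag hq hp1 hq1 f c hn (by norm_num : (0 : ℝ) ≤ 3) hV hflag
  norm_num at h
  exact h

/-! ### The plaquette prong can be blind: an explicit zero-bias observable at `ESS < 1` -/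

/-- **A blind observable.**  On `Fin 3` take the uniform model `q ≡ 1/3`, the target
`p = (1/2, 1/4, 1/4)` (weights `w = (3/2, 3/4, 3/4)`, `ESS = 8/9 < 1`) and the observable
`f = (0, 1, −1)`: `f` is non-constant under the model (`Var_q f = 2/3`) yet `E_p f = E_q f = 0`, so the
uncorrected sampler (planted control X-1) is EXACT on `f` and no sample size flags it through `f`.
The bias bound `sq_uncorrected_bias_le` is an upper bound only; what the plaquette prong sees is the
correlation of the observable with the weight, which an architecture or a symmetry can null. -/
theorem exists_uncorrected_blind_observable :
    ∃ p q f : Fin 3 → ℝ, (∀ x, 0 < p x) ∧ (∀ x, 0 < q x) ∧ ∑ x, p x = 1 ∧ ∑ x, q x = 1 ∧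
      essFrac p q = 8 / 9 ∧ 0 < ∑ x, q x * (f x - 0) ^ 2 ∧
      ∑ x, p x * f x - ∑ x, q x * f x = 0 := by
  refine ⟨![1/2, 1/4, 1/4], ![1/3, 1/3, 1/3], ![0, 1, -1], ?_, ?_, ?_, ?_, ?_, ?_, ?_⟩
  · intro x; fin_cases x <;> simp
  · intro x; fin_cases x <;> simp
  · simp [Fin.sum_univ_three]; norm_num
  · simp [Fin.sum_univ_three]; norm_num
  · simp [essFrac, weight, Fin.sum_univ_three]; norm_num
  · simp [Fin.sum_univ_three]
  · simp [Fin.sum_univ_three]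

end Summit.Ventures.LatticeQCDFlow.Scoring
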